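import Summits.AtomisticToContinuum.BoseEinsteinCondensation.Theses.BECRieszReverseHolder
import Literature.MathematicalPhysics.QuantumManyBody.BoseGasFreeDirichletBEC

/-!
# Coarse reverse-Hölder toolkit for route BECRieszReverseHolder

Classical ("Jensen twice + Cauchy–Schwarz") half of the glue around the informal item
`BoseRieszMembership` (stmt-AtomisticToContinuum-12602) and the crux `CoarseGrainedReverseHolder`:
for a weight `w` on the torus cell `[0,L)³` cut into `m³` congruent cubes `Q` (the cubes of
`CoarseGrainedReverseHolder`, identified with the Literature sub-cells `BoseGas.subCell (L/m)`),

* `m³ Σ_Q (∫_Q w)² ≤ L³ ∫_{[0,L)³} w²` (Cauchy–Schwarz in each cube, `m³|Q| = L³`);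
* `∫_{[0,L)³} e^{-h} ≥ L³` when `∫_{[0,L)³} h = 0` (`1 - u ≤ e^{-u}`, the first Jensen step);
* hence for a tilted weight `w = e^{-h}` with zero-mean `h` (e.g. `h = b·h_X̂`, the cavity field of the
  zero-mean periodic Riesz kernel): `m³ Σ_Q (∫_Q e^{-h})² / ∫_{[0,L)³} e^{-h} ≤ ∫_{[0,L)³} e^{-2h}` — the
  coarse RH₂ functional of the shadow slice is bounded by its `θ = 2` exponential moment.
-/

namespace Summit.AtomisticToContinuum.BoseEinsteinCondensation.Theorems.CoarseRH2

open MeasureTheory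
open scoped ENNReal
open Literature.MathematicalPhysics.QuantumManyBody BoseGas

/-- The cube `∏ᵢ [kᵢ L/m, (kᵢ+1) L/m)` of `CoarseGrainedReverseHolder` is the Literature sub-cell
`subCell (L/m) k`. -/
theorem setOf_forall_mem_Ico_eq_subCell (L : ℝ) (m : ℕ) (k : Fin 3 → Fin m) :
    {y : EuclideanSpace ℝ (Fin 3) |
        ∀ i, y i ∈ Set.Ico ((k i : ℝ) * (L / m)) (((k i : ℝ) + 1) * (L / m))} =
      subCell (L / m) k := by
  ext y
  rw [mem_subCell]
  simp only [Set.mem_setOf_eq, Set.mem_Ico]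
  refine forall_congr' fun i => ?_
  constructor <;> rintro ⟨h1, h2⟩ <;> constructor <;> linarith

/-- Sub-cells are translates of the cell: `|subCell ℓ q| = ℓ³` (`ℓ ≥ 0`). -/
theorem volume_subCell (ℓ : ℝ) {m : ℕ} (q : SubIdx m) :
    volume (subCell ℓ q) = ENNReal.ofReal ℓ ^ 3 := by
  have hset : subCell ℓ q = (fun x => x + -subOffset ℓ q) ⁻¹' cell ℓ := by
    ext x
    simp [subCell, cellShift, sub_eq_add_neg]
  rw [hset, measure_preimage_add_right, volume_cell]

/-- **Cauchy–Schwarz in a set**: `(∫_s w)² ≤ |s| ∫_s w²`. -/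
theorem sq_setLIntegral_le_volume_mul {w : Space → ℝ≥0∞} (hw : AEMeasurable w volume)
    (s : Set Space) :
    (∫⁻ x in s, w x) ^ 2 ≤ volume s * ∫⁻ x in s, w x ^ 2 := by
  set μ : Measure Space := volume.restrict s with hμ
  have h := ENNReal.lintegral_mul_le_Lp_mul_Lq μ Real.HolderConjugate.two_two hw.restrict
    (g := fun _ => 1) aemeasurable_const
  simp only [Pi.mul_apply, mul_one, lintegral_const, ENNReal.rpow_two, one_pow, one_mul] at h
  have hvol : μ Set.univ = volume s := by rw [hμ, Measure.restrict_apply_univ]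
  rw [hvol] at h
  calc (∫⁻ x in s, w x) ^ 2
      ≤ ((∫⁻ x in s, w x ^ 2) ^ (1 / 2 : ℝ) * volume s ^ (1 / 2 : ℝ)) ^ 2 := by gcongr
    _ = volume s * ∫⁻ x in s, w x ^ 2 := by
      rw [← ENNReal.mul_rpow_of_nonneg _ _ (by norm_num : (0 : ℝ) ≤ 1 / 2), ← ENNReal.rpow_two,
        ← ENNReal.rpow_mul]
      norm_num [mul_comm]

/-- **Coarse second moment ≤ fine second moment**: cutting `[0,L)³` into the `m³` congruent cubes
`Q_k = subCell (L/m) k`, `m³ Σ_k (∫_{Q_k} w)² ≤ L³ ∫_{[0,L)³} w²` for every measurable weight `w`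
(Cauchy–Schwarz in each cube and `m³ |Q| = L³`). -/
theorem natCast_pow_mul_sum_sq_setLIntegral_subCell_le {L : ℝ} (hL : 0 < L) {m : ℕ} (hm : 0 < m)
    {w : Space → ℝ≥0∞} (hw : AEMeasurable w volume) :
    (m : ℝ≥0∞) ^ 3 * ∑ k : Fin 3 → Fin m, (∫⁻ y in subCell (L / m) k, w y) ^ 2 ≤
      ENNReal.ofReal L ^ 3 * ∫⁻ y in cell L, w y ^ 2 := by
  have hm' : (0 : ℝ) < m := Nat.cast_pos.2 hm
  have hℓ : 0 < L / m := div_pos hL hm'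
  have hcube : ∀ k : Fin 3 → Fin m, (∫⁻ y in subCell (L / m) k, w y) ^ 2 ≤
      ENNReal.ofReal (L / m) ^ 3 * ∫⁻ y in subCell (L / m) k, w y ^ 2 := fun k => by
    simpa only [volume_subCell] using sq_setLIntegral_le_volume_mul hw (subCell (L / m) k)
  have hsum : ∑ k : Fin 3 → Fin m, ∫⁻ y in subCell (L / m) k, w y ^ 2 = ∫⁻ y in cell L, w y ^ 2 := by
    have h := sum_setLIntegral_subCell (k := m) hℓ (hw.pow_const 2)
    rwa [show (m : ℝ) * (L / m) = L by field_simp] at h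
  have hmL : (m : ℝ≥0∞) ^ 3 * ENNReal.ofReal (L / m) ^ 3 = ENNReal.ofReal L ^ 3 := by
    rw [← mul_pow, ← ENNReal.ofReal_natCast, ← ENNReal.ofReal_mul hm'.le,
      show (m : ℝ) * (L / m) = L by field_simp]
  calc (m : ℝ≥0∞) ^ 3 * ∑ k : Fin 3 → Fin m, (∫⁻ y in subCell (L / m) k, w y) ^ 2
      ≤ (m : ℝ≥0∞) ^ 3 * ∑ k : Fin 3 → Fin m,
          (ENNReal.ofReal (L / m) ^ 3 * ∫⁻ y in subCell (L / m) k, w y ^ 2) := by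
        gcongr with k
        exact hcube k
    _ = (m : ℝ≥0∞) ^ 3 * ENNReal.ofReal (L / m) ^ 3 *
          ∑ k : Fin 3 → Fin m, ∫⁻ y in subCell (L / m) k, w y ^ 2 := by
        rw [← Finset.mul_sum, mul_assoc]
    _ = ENNReal.ofReal L ^ 3 * ∫⁻ y in cell L, w y ^ 2 := by rw [hmL, hsum]

/-- **First Jensen step**: if `h` is integrable on the cell with `∫_{[0,L)³} h = 0` then
`L³ ≤ ∫_{[0,L)³} e^{-h}` (pointwise `1 - u ≤ e^{-u}`, integrated). -/
theorem ofReal_pow_le_setLIntegral_exp_neg {L : ℝ} (hL : 0 < L) {h : Space → ℝ}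
    (hint : IntegrableOn h (cell L) volume) (h0 : ∫ y in cell L, h y = 0) :
    ENNReal.ofReal L ^ 3 ≤ ∫⁻ y in cell L, ENNReal.ofReal (Real.exp (-h y)) := by
  have hvol : (volume (cell L)).toReal = L ^ 3 := by
    rw [volume_cell, ENNReal.toReal_pow, ENNReal.toReal_ofReal hL.le]
  have hfin : volume (cell L) ≠ ⊤ := by
    rw [volume_cell]; exact ENNReal.pow_ne_top ENNReal.ofReal_ne_top
  have hone : IntegrableOn (fun _ : Space => (1 : ℝ)) (cell L) volume := integrableOn_const (hs := hfin)
  have h1 : ∫ y in cell L, (1 - h y) = L ^ 3 := by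
    rw [integral_sub hone hint, h0, sub_zero, setIntegral_const, measureReal_def, hvol, smul_eq_mul,
      mul_one]
  -- the positive part of `1 - h` is integrable and dominated by `e^{-h}`
  have hpos : IntegrableOn (fun y => max (1 - h y) 0) (cell L) volume := (hone.sub hint).pos_part
  calc ENNReal.ofReal L ^ 3 = ENNReal.ofReal (∫ y in cell L, (1 - h y)) := by
        rw [h1, ENNReal.ofReal_pow hL.le]
    _ ≤ ENNReal.ofReal (∫ y in cell L, max (1 - h y) 0) :=
        ENNReal.ofReal_le_ofReal (integral_mono (hone.sub hint) hpos fun y => le_max_left _ _)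
    _ = ∫⁻ y in cell L, ENNReal.ofReal (max (1 - h y) 0) :=
        ofReal_integral_eq_lintegral_ofReal hpos (ae_of_all _ fun y => le_max_right _ _)
    _ ≤ ∫⁻ y in cell L, ENNReal.ofReal (Real.exp (-h y)) := by
        refine lintegral_mono fun y => ENNReal.ofReal_le_ofReal (max_le ?_ (Real.exp_pos _).le)
        linarith [Real.add_one_le_exp (-h y)]

/-- **Coarse RH₂ of a tilted slice ≤ its `θ = 2` exponential moment**: for a zero-mean integrable
landscape `h` on the cell `[0,L)³` cut into `m³` cubes `Q_k = subCell (L/m) k`,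
`m³ Σ_k (∫_{Q_k} e^{-h})² / ∫_{[0,L)³} e^{-h} ≤ ∫_{[0,L)³} e^{-2h}` — the per-slice functional of
`CoarseGrainedReverseHolder` for the shadow weight `e^{-b h_X̂}` (whose cavity field has zero cell
mean) is at most the `θ = 2` field moment that `RieszShadowFieldMoment` controls on average. -/
theorem coarseRH2_exp_neg_le_setLIntegral_exp {L : ℝ} (hL : 0 < L) {m : ℕ} (hm : 0 < m)
    {h : Space → ℝ} (hmeas : Measurable h) (hint : IntegrableOn h (cell L) volume)
    (h0 : ∫ y in cell L, h y = 0) :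
    (m : ℝ≥0∞) ^ 3 * (∑ k : Fin 3 → Fin m, (∫⁻ y in subCell (L / m) k, ENNReal.ofReal (Real.exp (-h y))) ^ 2) /
        (∫⁻ y in cell L, ENNReal.ofReal (Real.exp (-h y))) ≤
      ∫⁻ y in cell L, ENNReal.ofReal (Real.exp (-(2 * h y))) := by
  set w : Space → ℝ≥0∞ := fun y => ENNReal.ofReal (Real.exp (-h y)) with hw_def
  have hw : AEMeasurable w volume := (hmeas.neg.exp.ennreal_ofReal).aemeasurable
  have hw2 : ∀ y, w y ^ 2 = ENNReal.ofReal (Real.exp (-(2 * h y))) := fun y => by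
    rw [hw_def, ← ENNReal.ofReal_pow (Real.exp_pos _).le, ← Real.exp_nat_mul]
    ring_nf
  have hA := natCast_pow_mul_sum_sq_setLIntegral_subCell_le hL hm hw
  have hB := ofReal_pow_le_setLIntegral_exp_neg hL hint h0
  have hL3 : ENNReal.ofReal L ^ 3 ≠ 0 := pow_ne_zero _ (by simpa using hL)
  have hL3' : ENNReal.ofReal L ^ 3 ≠ ⊤ := ENNReal.pow_ne_top ENNReal.ofReal_ne_top
  simp_rw [hw2] at hA
  calc (m : ℝ≥0∞) ^ 3 * (∑ k : Fin 3 → Fin m, (∫⁻ y in subCell (L / m) k, w y) ^ 2) /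
          (∫⁻ y in cell L, w y)
      ≤ (ENNReal.ofReal L ^ 3 * ∫⁻ y in cell L, ENNReal.ofReal (Real.exp (-(2 * h y)))) /
          (ENNReal.ofReal L ^ 3) := ENNReal.div_le_div hA hB
    _ = ∫⁻ y in cell L, ENNReal.ofReal (Real.exp (-(2 * h y))) := by
        rw [mul_comm, ENNReal.mul_div_cancel_right hL3 hL3']

end Summit.AtomisticToContinuum.BoseEinsteinCondensation.Theorems.CoarseRH2
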